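import Mathlib.Data.Nat.Log
import HarnessLib

/-!
# K2DFS — data-free kernel checker for extended-code list completeness (qec-cdx-idea-1 g2, CARD-5; packaged by qec-cdx-eng-1)

The R144 (2) kernel path for K2 (completeness of the low-weight word lists of the extended "hook" codes of the CDX cell):
a syndrome-driven DFS with sibling-forbidding, `|U| ≤ M·r` pruning and min-type pivot cubes, over PACKED `Nat` tables
(field extraction = shift + mask, GMP-backed in the kernel), all recursion structural (on the budget `r` and the slot fuel), so
`decide` reduces `cube d p live T = true` directly.  Definitions VERBATIM from `run/shared/lean/pub/qec/cdx/idea-1/k2dfs/K2DFS.lean`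
(sha16 8212126fb073992b; correctness audit + independent re-run: qec-cdx-crit-1 2026-08-28T18:36Z; packed-table diff PASS 18:38Z);
only the namespace (tree convention) and docstrings are added here.  The SOUNDNESS theorem (CARD-5 §2: every non-trivial
zero-syndrome word of weight `≤ w` through the pivot, indecomposable, is a stop accepted by `stopOK`) is qec-cdx-type-1's file;
the per-code tables and cube facts are `K2TablesBB72.lean` / `K2CubesBB72*.lean`.  Nothing here asserts anything about a code.
-/

namespace Summit.Ventures.QEC.CircuitDistance.K2DFS


/-- Packed tables of an extended code: `C` checks, `K` logical parities, `B` bits per candidate slot, `S` slots per check, packed syndrome / logical / candidate tables, prune bound `M`, weight bound `w` (idea-1 CARD-5). -/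
structure Data where
  C : Nat      -- number of checks  (field width of SYN)
  K : Nat      -- number of logical parities (field width of LGM)
  B : Nat      -- bits per candidate slot (generator index + 1 fits; slot value 0 = empty)
  S : Nat      -- candidate slots per check (21 for the BB depth-7 extended codes)
  SYN : Nat    -- packed: syn g  = (SYN >>> (g*C)) &&& (2^C-1)
  LGM : Nat    -- packed: lgm g  = (LGM >>> (g*K)) &&& (2^K-1)
  CAND : Nat   -- packed: slot (c,j) = (CAND >>> ((c*S+j)*B)) &&& (2^B-1) = g+1 of the j-th generator through check c (increasing), 0 if none
  M : Nat      -- max syndrome weight of a generator (prune-M)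
  w : Nat      -- weight bound
  deriving Inhabited

/-- Syndrome mask of generator `g`. -/
@[inline] def Data.syn (d : Data) (g : Nat) : Nat := (d.SYN >>> (g * d.C)) &&& (2 ^ d.C - 1)
/-- Logical-parity mask of generator `g`. -/
@[inline] def Data.lgm (d : Data) (g : Nat) : Nat := (d.LGM >>> (g * d.K)) &&& (2 ^ d.K - 1)
/-- Candidate slot `j` of check `c` (`g+1`, or `0` = empty). -/
@[inline] def Data.slot (d : Data) (c j : Nat) : Nat := (d.CAND >>> ((c * d.S + j) * d.B)) &&& (2 ^ d.B - 1)

/-- `popLE u k = true ↔ popcount u ≤ k`. -/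
def popLE : Nat → Nat → Bool
  | u, 0     => u == 0
  | u, k + 1 => u == 0 || popLE (u &&& (u - 1)) k

/-- index of the lowest set bit of `u ≠ 0`. -/
def lowBit (u : Nat) : Nat := Nat.log2 (u ^^^ (u &&& (u - 1)))

/-- at a stop (U = 0): trivial, or (|W| ≥ w-1 and W is an allowed word). -/
def stopOK (d : Data) (T : List Nat) (L Wm card : Nat) : Bool :=
  (L == 0) || ((d.w - 1 ≤ card) && T.contains Wm)

/-- candidate slots j = S-fuel … with progressive forbidding; `k` = recursive call for children. -/
def goSlots (d : Data) (k : Nat → Nat → Nat → Nat → Nat → Bool) (c U L Wm card : Nat) :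
    Nat → Nat → Nat → Bool
  | 0,        _, _    => true
  | fuel + 1, j, live =>
    let s := d.slot c j
    if s == 0 then true
    else
      let h := s - 1
      if live.testBit h then
        let live' := live ^^^ (1 <<< h)
        k (U ^^^ d.syn h) (L ^^^ d.lgm h) live' (Wm ||| (1 <<< h)) (card + 1)
          && goSlots d k c U L Wm card fuel (j + 1) live'
      else goSlots d k c U L Wm card fuel (j + 1) live

/-- the DFS below a state; `false` iff a nontrivial stop that is not OK exists below. Structural on `r`. -/
def dfs (d : Data) (T : List Nat) : Nat → Nat → Nat → Nat → Nat → Nat → Bool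
  | 0,     U, L, _,    Wm, card => (U != 0) || stopOK d T L Wm card
  | r + 1, U, L, live, Wm, card =>
    if U == 0 then stopOK d T L Wm card
    else if !(popLE U (d.M * (r + 1))) then true
    else goSlots d (dfs d T r) (lowBit U) U L Wm card d.S 0 live

/-- one cube: pivot generator `p`, live mask (p excluded), allowed nontrivial stops `T` (as generator masks). -/
def cube (d : Data) (p live : Nat) (T : List Nat) : Bool :=
  dfs d T (d.w - 1) (d.syn p) (d.lgm p) live (1 <<< p) 1

end Summit.Ventures.QEC.CircuitDistance.K2DFS
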